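import Summits.QuantumFields.YangMills.Theorems.UnitScaleTiltProp7LaplaceAcFlatTransfer
import HarnessLib

/-!
# `UnitScaleTiltProp7HilbertTranslationT3` — THE LATTICE TRANSLATIONS OF THE FINE TORUS ON THE HILBERT LETTERS OF [Balaban1985BackgroundPropagators] §3 AT A T³ MEMBER:
# unitary on `SiteL2K`∕`BondL2K`, commuting with the flat letters `D_1`, `D*_1`, `Δ^η_1 = D*_1D_1` and the flat Wilson Hessian `Δ^η(1)`; hence **COMB-FLAT COERCIVITY ⟸
# (the comb gauge projector is the TRANSLATE of the S one) + (the slice bound)** — ✓`Prop7LaplaceAcFlatTransfer.coercive_laplaceAc_one_of_sliceBound_conj` with its isometry rows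
# (hτn) (hτs) (hτΔ) DISCHARGED at `τ :=` a lattice translation, its projector row re-displayed on the gauge parameters
(route `UnitScaleTilt`, crux K1 «MinimiserStabilityRegPr» stmt-QuantumFields-19200; ★★OWNER ym3-torus-plan g29 RULING №18 «HALF-BLOCK OFFSET — keep `basePt`, identify comb∕S at the flat
member by the lattice translation τ: `N_c(1) = τ·N_S(1)`, `Rc 1 = τ RS 1 τ⁻¹`, `Qkc 1 = τ Qk 1 τ⁻¹ + δQ`; COMB-FLAT-COERCIVITY := FILE B ∘ τ + isometry transfer + (I3′)»; item (b1) «τ on the Hilbert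
letters» named by the row's pen px6 g5 2026-08-29T04:36:18Z; LOCATE memo `LOCATE-COMBFLAT-B1-TAU-px13g6.md` = 19200 evidence #51; def-free, count-neutral).
Cell `ym3-torus` (HUMAN RULING D-0037, YM ladder rung R3 — YM₃ on T³ is a rung, not d = 4, not infinite volume, not a mass gap, not Clay), width seat `ym3-torus-px13` (gen 6).

THE PRINT.  [Balaban1985BackgroundPropagators] p. 391–394: the `L²` spaces of gauge parameters `λ` (sites) and vector fields `A` (bonds) of the torus `T_η` with the scalar products (3.11),
the covariant derivative (3.3) `D^η_{U₀}`, its adjoint (3.8) `D^{η*}_{U₀}`, `Δ^η_U = D^{η*}_U D^η_U` (3.23), the Hessian `Δ^η(U)` (3.10), the gauge projector `R(U)` (3.21) and `Δ_a = Δ + DRD* + Q*aQ`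
(3.26); [Balaban1984PropagatorsI] §1: at `U ≡ 1` these are the translation-invariant finite-difference operators `∂`, `∂*`, `Δ`, `∂*∂` of the periodic lattice ((1.2), (1.4), (1.21)), diagonalised
by the lattice Fourier transform (Prop. 1.1 p. 33) — translation invariance is the (unstated, used) symmetry behind every flat estimate of [B5] §1 and [B6] §2.  The AVERAGING operators `Q`, `Q′`
are only BLOCK-periodic; the route's comb average `QTw` reads print's corner-anchored boxes `x̂ + [0, L^{K−n})³` while the S objects read the T³ blocks centred at `x̂` (✓`Prop7CombChartFlatPureGauge`,
LOCATE addendum (F*) of px6 g5): the two flat gauge classes differ by the half-block translation, whence RULING №18's conjugated identification.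

WHAT IS PROVED (sorry-free, no definition; member `F`, heights `n ≤ K`, weights `c₀ cB`; translation vector `v : Site (F.P K) 0` ARBITRARY; `M₂ := Matrix (Fin 2) (Fin 2) ℂ`;
translated carriers written `fun b => X (b.translate v)` (= lit `GaugeField.translate v X`) and `fun x => λ (x + v)`; the Hilbert translations are the explicit conjugates
`τB v := toL2 ∘ (· ∘ translate v) ∘ toL2⁻¹`, `τS v := toL2S ∘ (· ∘ (· + v)) ∘ toL2S⁻¹`, spelled out as `LinearEquiv` terms where an operator statement is wanted):
* §1 [folklore] lattice calculus: `grad`, `diverg`, `laplace`, `curl` commute with translations (lit `Site.shift_add`, `Site.unshift_add`); bond∕site∕plaquette sums are translation invariant.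
* §2 the weighted `L²` norms and scalar products are translation invariant (`norm_toL2_translate`, `inner_toL2_translate`, `norm_toL2S_translate`, `inner_toL2S_translate`); the conjugates
  `τB v`, `τS v` act as stated on `toL2 X`, `toL2S λ` and are isometries (rows (hτn), (hτs) of the conjugated transfer).
* §3 ★★ at the flat member `U₀ = 1`: `D_1 ∘ τS = τB ∘ D_1`, `D*_1 ∘ τB = τS ∘ D*_1`, `Δ^η_1 ∘ τS = τS ∘ Δ^η_1` (through ✓`Prop7FlatProjectorSeam`'s flat stencils), and the flat Wilson Hessian form is
  invariant, `re⟨τB y, Δ^η(1) τB y⟩ = re⟨y, Δ^η(1) y⟩` (row (hτΔ); ✓`re_inner_DeltaEta_one` = `c₀η⁻²Σ_p‖curl X‖²` re-indexed over translated plaquettes); packaged for the (b2) pen as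
  ★★`exists_linearIsometryEquiv_translate`: linear ISOMETRIC equivalences `eS`, `eB` of `SiteL2K`, `BondL2K` acting as the translations on `toL2S λ`, `toL2 X` and intertwining `D_1`, `D*_1`, `Δ^η_1`
  — so that Mathlib's conjugation lemma for `Submodule.starProjection` applies to `RS 1 = projR (covLapSite 1) (QDS 1)` (✓`RS_eq_projR`) once (b2) identifies `NSc 1 = (NS 1).map eS`.
* §4 ★★★ `coercive_laplaceAc_one_of_sliceBound_translate` — COMB-FLAT COERCIVITY at the flat member from FILE B (✓`coercive_laplaceA_one`, inside ✓p695948) and TWO displayed rows: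
  (hR) `‖R_c(1)(toL2S (λ ∘ (· + v)))‖ = ‖R_S(1)(toL2S λ)‖` (the projector identity of RULING №18 in norm form, (b2)'s) and (hv) the slice bound for `Q_kᶜ(1) ∘ τB v − Q_k(1)` ((I3′)'s), with the
  K∕volume-free constant `1∕(4·Cst 3 a₀·(2+2ρ))`.
HONEST FRAMING.  Bookkeeping: sum re-indexing and three flat stencils; no estimate; rows (hR), (hv) displayed, not proved; nothing of (b2), (I3′), COMB-FLAT-COERCIVITY's content, HESS, E′, EX or the
crux K1 is proved; rung R3, not Clay; YM gap NOT proved.  `--supports stmt-QuantumFields-19200 --as helper`.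
References: T. Bałaban, CMP 99 (1985) 389–434 [Balaban1985BackgroundPropagators] ((3.3) p.391, (3.8)–(3.11) p.392, (3.21)–(3.23) p.394, (3.26) p.395, Thm 3.11 p.416, (3.115) p.418);
CMP 95 (1984) 17–40 [Balaban1984PropagatorsI] ((1.2)–(1.4) p.18, (1.21) p.21, Prop. 1.1 (1.89)–(1.90) p.33); CMP 96 (1984) 223–250 [Balaban1984PropagatorsII] ((2.10)–(2.12) pp.224–225).
-/

noncomputable section

open scoped InnerProductSpace ComplexConjugate Matrix.Norms.L2Operator BigOperators

namespace Summit.QuantumFields.YangMills.Theorems.Prop7HilbertTranslation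

open Literature.MathematicalPhysics.QuantumFieldTheory.Balaban1983to89
open Literature.MathematicalPhysics.QuantumFieldTheory.Balaban1983to89.T3ContinuumYM3Torus
open T3SectALandauChart (eta eta_pos)
open LatticeFieldCalculus (curl diverg grad laplace)
open B9Eq311L2Pairing (WL2)
open B11Eq103H1Complex (SiteL2K BondL2K)
open Summit.QuantumFields.YangMills.Theorems.Prop7SectET3Transport (periodsT3)
open Summit.QuantumFields.YangMills.Theorems.Prop7SectET3HilbertLetters (W₂ toL2 toL2S toL2B DL2 DstarL2 covLapSite inner_toL2)
open Summit.QuantumFields.YangMills.Theorems.Prop7SectET3GaugeProjector (RS)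
open Summit.QuantumFields.YangMills.Theorems.Prop7SectET3WilsonHessian (DeltaEta)
open Summit.QuantumFields.YangMills.Theorems.Prop7SectET3CurvedPropagators (Qk laplaceA)
open Summit.QuantumFields.YangMills.Theorems.Prop7SectET3CombLetters (Rc Qkc laplaceAc)
open Summit.QuantumFields.YangMills.Theorems.Prop7SectET3RealCoordSums (inner_toL2S)
open Summit.QuantumFields.YangMills.Theorems.Prop7LaplaceAFlatLetters (re_inner_DeltaEta_one norm_sq_toL2 norm_sq_toL2S)
open Summit.QuantumFields.YangMills.Theorems.Prop7FlatProjectorSeam (DL2_one_eq_grad DstarL2_one_eq_diverg covLapSite_one_eq_laplace)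
open Summit.QuantumFields.YangMills.Theorems.Prop7LaplaceAcFlatTransfer (coercive_laplaceAc_one_of_sliceBound_conj)

/-! ## §1 The flat lattice calculus commutes with translations; lattice sums are translation invariant -/

section Lattice

variable {P : Params} {j : ℕ} {V : Type*} [AddCommGroup V] [Module ℝ V]

/-- The gradient commutes with translations: `∂(λ(· + v))(b) = (∂λ)(b + v)` (lit `PBond.translate_tgt`: `(b + v)₊ = b₊ + v`). [cite: Balaban1984PropagatorsI, (1.4) p.18] -/
theorem grad_translate (c : ℝ) (lam : Site P j → V) (v : Site P j) :
    grad c (fun x => lam (x + v)) = fun b => grad c lam (b.translate v) := by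
  funext b
  simp only [LatticeFieldCalculus.grad, PBond.translate_tgt, PBond.translate_src]

/-- The divergence commutes with translations: `∂*(A(· + v))(x) = (∂*A)(x + v)` (lit `Site.unshift_add`). [cite: Balaban1984PropagatorsI, (1.21) p.21] -/
theorem diverg_translate (c : ℝ) (A : PBond P j → V) (v : Site P j) :
    diverg c (fun b => A (b.translate v)) = fun x => diverg c A (x + v) := by
  funext x
  simp only [LatticeFieldCalculus.diverg, PBond.translate, Site.unshift_add]

/-- The Laplacian commutes with translations: `Δ(f(· + v))(x) = (Δf)(x + v)`. [cite: Balaban1984PropagatorsI, (1.21) p.21] -/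
theorem laplace_translate (c : ℝ) (f : Site P j → V) (v : Site P j) :
    laplace c (fun x => f (x + v)) = fun x => laplace c f (x + v) := by
  funext x
  simp only [LatticeFieldCalculus.laplace, Site.shift_add, Site.unshift_add]

/-- The curl commutes with translations: `(∂(A(· + v)))(p) = (∂A)(p + v)`. [cite: Balaban1984PropagatorsI, (1.2) p.18] -/
theorem curl_translate (c : ℝ) (A : PBond P j → V) (v : Site P j) (p : Plaq P j) :
    curl c (fun b => A (b.translate v)) p = curl c A (p.translate v) := by
  simp only [LatticeFieldCalculus.curl, PBond.translate, Plaq.translate, Site.shift_add]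

/-- Bond sums are translation invariant: `Σ_b f(b + v) = Σ_b f(b)` (re-indexing by lit `PBond.translateEquiv v`). [folklore] -/
theorem sum_pbond_translate {M : Type*} [AddCommMonoid M] (v : Site P j) (f : PBond P j → M) : ∑ b : PBond P j, f (b.translate v) = ∑ b, f b :=
  Fintype.sum_equiv (PBond.translateEquiv v) _ _ fun _ => rfl

/-- Site sums are translation invariant: `Σ_x f(x + v) = Σ_x f(x)`. [folklore] -/
theorem sum_site_translate {M : Type*} [AddCommMonoid M] (v : Site P j) (f : Site P j → M) : ∑ x : Site P j, f (x + v) = ∑ x, f x :=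
  Fintype.sum_equiv (Equiv.addRight v) _ _ fun _ => rfl

/-- Plaquette sums are translation invariant: `Σ_p f(p + v) = Σ_p f(p)` (lit `Plaq.translateEquiv v`). [folklore] -/
theorem sum_plaq_translate {M : Type*} [AddCommMonoid M] (v : Site P j) (f : Plaq P j → M) : ∑ p : Plaq P j, f (p.translate v) = ∑ p, f p :=
  Fintype.sum_equiv (Plaq.translateEquiv v) _ _ fun _ => rfl

/-- Translating by `v` and then by `−v` is the identity on bonds. [folklore] -/
theorem translate_translate_neg (v : Site P j) (b : PBond P j) : (b.translate v).translate (-v) = b := by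
  rw [PBond.translate_translate, add_neg_cancel]
  cases b
  simp [PBond.translate]

/-- Translating by `−v` and then by `v` is the identity on bonds. [folklore] -/
theorem translate_neg_translate (v : Site P j) (b : PBond P j) : (b.translate (-v)).translate v = b := by
  rw [PBond.translate_translate, neg_add_cancel]
  cases b
  simp [PBond.translate]

end Lattice

/-! ## §2 The weighted `L²` letters are translation invariant; the Hilbert translations `τB v`, `τS v` -/

section Hilbert

variable {F : T3Family} {n K : ℕ} {c₀ : ℝ} [Fact (0 < c₀)]

/-- **THE FINE `L²` NORM IS TRANSLATION INVARIANT**: `‖toL2 (X(· + v))‖ = ‖toL2 X‖` ((3.11) is a sum over all bonds of `T_η`). [cite: Balaban1985BackgroundPropagators, (3.11) p.392] -/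
theorem norm_toL2_translate (v : Site (F.P K) 0) (X : PBond (F.P K) 0 → Matrix (Fin 2) (Fin 2) ℂ) :
    ‖toL2 F K c₀ (fun b => X (b.translate v))‖ = ‖toL2 F K c₀ X‖ := by
  have h : ‖toL2 F K c₀ (fun b => X (b.translate v))‖ ^ 2 = ‖toL2 F K c₀ X‖ ^ 2 := by
    rw [norm_sq_toL2, norm_sq_toL2, sum_pbond_translate v (fun b => ∑ i, ∑ i', ‖X b i i'‖ ^ 2)]
  exact (sq_eq_sq₀ (norm_nonneg _) (norm_nonneg _)).1 h

/-- The fine `L²` scalar product is translation invariant: `⟨toL2 (X(· + v)), toL2 (Y(· + v))⟩ = ⟨toL2 X, toL2 Y⟩`. [cite: Balaban1985BackgroundPropagators, (3.11) p.392] -/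
theorem inner_toL2_translate (v : Site (F.P K) 0) (X Y : PBond (F.P K) 0 → Matrix (Fin 2) (Fin 2) ℂ) :
    ⟪toL2 F K c₀ (fun b => X (b.translate v)), toL2 F K c₀ (fun b => Y (b.translate v))⟫_ℂ = ⟪toL2 F K c₀ X, toL2 F K c₀ Y⟫_ℂ := by
  rw [inner_toL2, inner_toL2, sum_pbond_translate v (fun b => Matrix.trace ((X b).conjTranspose * Y b))]

/-- **THE SITE `L²` NORM IS TRANSLATION INVARIANT**: `‖toL2S (λ(· + v))‖ = ‖toL2S λ‖`. [cite: Balaban1985BackgroundPropagators, (3.11) p.392] -/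
theorem norm_toL2S_translate (v : Site (F.P K) 0) (lam : Site (F.P K) 0 → Matrix (Fin 2) (Fin 2) ℂ) :
    ‖toL2S F K c₀ (fun x => lam (x + v))‖ = ‖toL2S F K c₀ lam‖ := by
  have h : ‖toL2S F K c₀ (fun x => lam (x + v))‖ ^ 2 = ‖toL2S F K c₀ lam‖ ^ 2 := by
    rw [norm_sq_toL2S, norm_sq_toL2S, sum_site_translate v (fun x => ∑ i, ∑ i', ‖lam x i i'‖ ^ 2)]
  exact (sq_eq_sq₀ (norm_nonneg _) (norm_nonneg _)).1 h

/-- The site `L²` scalar product is translation invariant. [cite: Balaban1985BackgroundPropagators, (3.11) p.392] -/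
theorem inner_toL2S_translate (v : Site (F.P K) 0) (lam mu : Site (F.P K) 0 → Matrix (Fin 2) (Fin 2) ℂ) :
    ⟪toL2S F K c₀ (fun x => lam (x + v)), toL2S F K c₀ (fun x => mu (x + v))⟫_ℂ = ⟪toL2S F K c₀ lam, toL2S F K c₀ mu⟫_ℂ := by
  rw [inner_toL2S, inner_toL2S, sum_site_translate v (fun x => Matrix.trace ((lam x).conjTranspose * mu x))]

omit [Fact (0 < c₀)] in
/-- **THE BOND-SPACE TRANSLATION `τB v` ACTS AS THE TRANSLATION OF THE VECTOR FIELD**: `τB v (toL2 X) = toL2 (X(· + v))`, `τB v := toL2 ∘ (· ∘ translate v) ∘ toL2⁻¹` spelled out as a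
`LinearEquiv` (lit `PBond.translateEquiv v`). [cite: Balaban1985BackgroundPropagators, (3.11) p.392] -/
theorem tauB_toL2 (v : Site (F.P K) 0) (X : PBond (F.P K) 0 → Matrix (Fin 2) (Fin 2) ℂ) :
    ((toL2 F K c₀).symm.trans ((LinearEquiv.funCongrLeft ℂ (Matrix (Fin 2) (Fin 2) ℂ) (PBond.translateEquiv v)).trans (toL2 F K c₀))) (toL2 F K c₀ X)
      = toL2 F K c₀ (fun b => X (b.translate v)) := by
  rw [LinearEquiv.trans_apply, LinearEquiv.trans_apply, LinearEquiv.symm_apply_apply]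
  rfl

omit [Fact (0 < c₀)] in
/-- **THE SITE-SPACE TRANSLATION `τS v` ACTS AS THE TRANSLATION OF THE GAUGE PARAMETER**: `τS v (toL2S λ) = toL2S (λ(· + v))`, `τS v := toL2S ∘ (· ∘ (· + v)) ∘ toL2S⁻¹` (Mathlib
`Equiv.addRight v` on the torus sites, lit `Site.instAddCommGroup`). [cite: Balaban1985BackgroundPropagators, (3.11) p.392] -/
theorem tauS_toL2S (v : Site (F.P K) 0) (lam : Site (F.P K) 0 → Matrix (Fin 2) (Fin 2) ℂ) :
    ((toL2S F K c₀).symm.trans ((LinearEquiv.funCongrLeft ℂ (Matrix (Fin 2) (Fin 2) ℂ) (Equiv.addRight v)).trans (toL2S F K c₀))) (toL2S F K c₀ lam)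
      = toL2S F K c₀ (fun x => lam (x + v)) := by
  rw [LinearEquiv.trans_apply, LinearEquiv.trans_apply, LinearEquiv.symm_apply_apply]
  rfl

/-- ★ **`τB v` IS AN ISOMETRY** — row (hτn) of ✓`coercive_laplaceAc_one_of_sliceBound_conj`: `‖τB v y‖ = ‖y‖` for every `y`. [cite: Balaban1985BackgroundPropagators, (3.11) p.392] -/
theorem norm_tauB (v : Site (F.P K) 0) (y : BondL2K ℂ 3 (periodsT3 F K) c₀ W₂) :
    ‖((toL2 F K c₀).symm.trans ((LinearEquiv.funCongrLeft ℂ (Matrix (Fin 2) (Fin 2) ℂ) (PBond.translateEquiv v)).trans (toL2 F K c₀))) y‖ = ‖y‖ := by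
  obtain ⟨X, rfl⟩ := (toL2 F K c₀).surjective y
  rw [tauB_toL2, norm_toL2_translate]

/-- ★ **`τS v` IS AN ISOMETRY**: `‖τS v u‖ = ‖u‖` for every `u`. [cite: Balaban1985BackgroundPropagators, (3.11) p.392] -/
theorem norm_tauS (v : Site (F.P K) 0) (u : SiteL2K ℂ 3 (periodsT3 F K) c₀ W₂) :
    ‖((toL2S F K c₀).symm.trans ((LinearEquiv.funCongrLeft ℂ (Matrix (Fin 2) (Fin 2) ℂ) (Equiv.addRight v)).trans (toL2S F K c₀))) u‖ = ‖u‖ := by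
  obtain ⟨lam, rfl⟩ := (toL2S F K c₀).surjective u
  rw [tauS_toL2S, norm_toL2S_translate]

omit [Fact (0 < c₀)] in
/-- `τB v` IS ONTO — row (hτs) of the conjugated transfer (a linear equivalence; its inverse is `τB (−v)`). [folklore] -/
theorem tauB_surjective (v : Site (F.P K) 0) :
    Function.Surjective
      (((toL2 F K c₀).symm.trans ((LinearEquiv.funCongrLeft ℂ (Matrix (Fin 2) (Fin 2) ℂ) (PBond.translateEquiv v)).trans (toL2 F K c₀))).toLinearMap :
        BondL2K ℂ 3 (periodsT3 F K) c₀ W₂ →ₗ[ℂ] BondL2K ℂ 3 (periodsT3 F K) c₀ W₂) :=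
  fun y => ⟨_, LinearEquiv.apply_symm_apply _ y⟩

end Hilbert

/-! ## §3 ★★ At the flat member the translations commute with `D_1`, `D*_1`, `Δ^η_1` and preserve the flat Wilson Hessian form -/

section Flat

variable {F : T3Family} {n K : ℕ} {c₀ : ℝ} [Fact (0 < c₀)]

/-- At the flat member `D_1 (toL2S λ) = toL2 (∂λ)`, `∂ = grad η⁻¹` (✓`DL2_one_eq_grad` read forward). [cite: Balaban1985BackgroundPropagators, (3.3) p.391] -/
theorem DL2_one_toL2S_eq (lam : Site (F.P K) 0 → Matrix (Fin 2) (Fin 2) ℂ) :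
    DL2 F n K c₀ 1 (toL2S F K c₀ lam) = toL2 F K c₀ (grad (eta F n K)⁻¹ lam) := by
  rw [← DL2_one_eq_grad F n K c₀ lam, LinearEquiv.apply_symm_apply]

/-- At the flat member `D*_1 (toL2 X) = toL2S (∂*X)`, `∂* = diverg η⁻¹` (✓`DstarL2_one_eq_diverg` read forward). [cite: Balaban1985BackgroundPropagators, (3.8) p.392] -/
theorem DstarL2_one_toL2_eq (X : PBond (F.P K) 0 → Matrix (Fin 2) (Fin 2) ℂ) :
    DstarL2 F n K c₀ 1 (toL2 F K c₀ X) = toL2S F K c₀ (diverg (eta F n K)⁻¹ X) := by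
  rw [← DstarL2_one_eq_diverg F n K c₀ X, LinearEquiv.apply_symm_apply]

/-- At the flat member `Δ^η_1 (toL2S λ) = toL2S (Δλ)`, `Δ = laplace η⁻¹` (✓`covLapSite_one_eq_laplace` read forward). [cite: Balaban1985BackgroundPropagators, (3.23) p.394] -/
theorem covLapSite_one_toL2S_eq (lam : Site (F.P K) 0 → Matrix (Fin 2) (Fin 2) ℂ) :
    covLapSite F n K c₀ 1 (toL2S F K c₀ lam) = toL2S F K c₀ (laplace (eta F n K)⁻¹ lam) := by
  rw [← covLapSite_one_eq_laplace F n K c₀ lam, LinearEquiv.apply_symm_apply]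

/-- ★★ **`D_1` COMMUTES WITH TRANSLATIONS** (carrier form): `D_1 (toL2S (λ(· + v))) = toL2 ((toL2⁻¹ D_1 toL2S λ)(· + v))`. [cite: Balaban1985BackgroundPropagators, (3.3) p.391; Balaban1984PropagatorsI, (1.4) p.18] -/
theorem DL2_one_translate (v : Site (F.P K) 0) (lam : Site (F.P K) 0 → Matrix (Fin 2) (Fin 2) ℂ) :
    DL2 F n K c₀ 1 (toL2S F K c₀ (fun x => lam (x + v)))
      = toL2 F K c₀ (fun b => (toL2 F K c₀).symm (DL2 F n K c₀ 1 (toL2S F K c₀ lam)) (b.translate v)) := by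
  rw [DL2_one_toL2S_eq, DL2_one_eq_grad, grad_translate]

/-- ★★ **`D_1 ∘ τS v = τB v ∘ D_1`** (operator form on the Hilbert letters). [cite: Balaban1985BackgroundPropagators, (3.3) p.391; Balaban1984PropagatorsI, (1.4) p.18] -/
theorem DL2_one_tauS (v : Site (F.P K) 0) (u : SiteL2K ℂ 3 (periodsT3 F K) c₀ W₂) :
    DL2 F n K c₀ 1 (((toL2S F K c₀).symm.trans ((LinearEquiv.funCongrLeft ℂ (Matrix (Fin 2) (Fin 2) ℂ) (Equiv.addRight v)).trans (toL2S F K c₀))) u)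
      = ((toL2 F K c₀).symm.trans ((LinearEquiv.funCongrLeft ℂ (Matrix (Fin 2) (Fin 2) ℂ) (PBond.translateEquiv v)).trans (toL2 F K c₀)))
          (DL2 F n K c₀ 1 u) := by
  obtain ⟨lam, rfl⟩ := (toL2S F K c₀).surjective u
  rw [tauS_toL2S, DL2_one_toL2S_eq, DL2_one_toL2S_eq, tauB_toL2, grad_translate]

/-- ★★ **`D*_1` COMMUTES WITH TRANSLATIONS** (carrier form): `D*_1 (toL2 (X(· + v))) = toL2S ((toL2S⁻¹ D*_1 toL2 X)(· + v))`. [cite: Balaban1985BackgroundPropagators, (3.8) p.392; Balaban1984PropagatorsI, (1.21) p.21] -/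
theorem DstarL2_one_translate (v : Site (F.P K) 0) (X : PBond (F.P K) 0 → Matrix (Fin 2) (Fin 2) ℂ) :
    DstarL2 F n K c₀ 1 (toL2 F K c₀ (fun b => X (b.translate v)))
      = toL2S F K c₀ (fun x => (toL2S F K c₀).symm (DstarL2 F n K c₀ 1 (toL2 F K c₀ X)) (x + v)) := by
  rw [DstarL2_one_toL2_eq, DstarL2_one_eq_diverg, diverg_translate]

/-- ★★ **`D*_1 ∘ τB v = τS v ∘ D*_1`** (operator form). [cite: Balaban1985BackgroundPropagators, (3.8) p.392; Balaban1984PropagatorsI, (1.21) p.21] -/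
theorem DstarL2_one_tauB (v : Site (F.P K) 0) (y : BondL2K ℂ 3 (periodsT3 F K) c₀ W₂) :
    DstarL2 F n K c₀ 1 (((toL2 F K c₀).symm.trans ((LinearEquiv.funCongrLeft ℂ (Matrix (Fin 2) (Fin 2) ℂ) (PBond.translateEquiv v)).trans (toL2 F K c₀))) y)
      = ((toL2S F K c₀).symm.trans ((LinearEquiv.funCongrLeft ℂ (Matrix (Fin 2) (Fin 2) ℂ) (Equiv.addRight v)).trans (toL2S F K c₀)))
          (DstarL2 F n K c₀ 1 y) := by
  obtain ⟨X, rfl⟩ := (toL2 F K c₀).surjective y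
  rw [tauB_toL2, DstarL2_one_toL2_eq, DstarL2_one_toL2_eq, tauS_toL2S, diverg_translate]

/-- ★★ **`Δ^η_1` COMMUTES WITH TRANSLATIONS** (carrier form): `Δ^η_1 (toL2S (λ(· + v))) = toL2S ((toL2S⁻¹ Δ^η_1 toL2S λ)(· + v))` — the row the (b2) pen needs to transport the orthogonal
projection `R_S(1)` onto `Δ^η_1 N_S(1)` (✓`RS_eq_projR`). [cite: Balaban1985BackgroundPropagators, (3.21)–(3.23) p.394] -/
theorem covLapSite_one_translate (v : Site (F.P K) 0) (lam : Site (F.P K) 0 → Matrix (Fin 2) (Fin 2) ℂ) :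
    covLapSite F n K c₀ 1 (toL2S F K c₀ (fun x => lam (x + v)))
      = toL2S F K c₀ (fun x => (toL2S F K c₀).symm (covLapSite F n K c₀ 1 (toL2S F K c₀ lam)) (x + v)) := by
  rw [covLapSite_one_toL2S_eq, covLapSite_one_eq_laplace, laplace_translate]

/-- ★★ **`Δ^η_1 ∘ τS v = τS v ∘ Δ^η_1`** (operator form). [cite: Balaban1985BackgroundPropagators, (3.23) p.394; Balaban1984PropagatorsI, (1.21) p.21] -/
theorem covLapSite_one_tauS (v : Site (F.P K) 0) (u : SiteL2K ℂ 3 (periodsT3 F K) c₀ W₂) :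
    covLapSite F n K c₀ 1 (((toL2S F K c₀).symm.trans ((LinearEquiv.funCongrLeft ℂ (Matrix (Fin 2) (Fin 2) ℂ) (Equiv.addRight v)).trans (toL2S F K c₀))) u)
      = ((toL2S F K c₀).symm.trans ((LinearEquiv.funCongrLeft ℂ (Matrix (Fin 2) (Fin 2) ℂ) (Equiv.addRight v)).trans (toL2S F K c₀)))
          (covLapSite F n K c₀ 1 u) := by
  obtain ⟨lam, rfl⟩ := (toL2S F K c₀).surjective u
  rw [tauS_toL2S, covLapSite_one_toL2S_eq, covLapSite_one_toL2S_eq, tauS_toL2S, laplace_translate]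

/-- ★★ **THE FLAT WILSON HESSIAN FORM IS TRANSLATION INVARIANT**: `re⟨toL2 (X(· + v)), Δ^η(1) toL2 (X(· + v))⟩ = re⟨toL2 X, Δ^η(1) toL2 X⟩` — ✓`re_inner_DeltaEta_one` (`= c₀η⁻²Σ_p‖(curl₁X)(p)‖²`)
and the re-indexing of the plaquette sum by `p ↦ p + v`. [cite: Balaban1985BackgroundPropagators, (3.10) p.392; Balaban1984PropagatorsI, (1.2) p.18] -/
theorem re_inner_DeltaEta_one_translate (v : Site (F.P K) 0) (X : PBond (F.P K) 0 → Matrix (Fin 2) (Fin 2) ℂ) :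
    RCLike.re ⟪toL2 F K c₀ (fun b => X (b.translate v)), DeltaEta F n K c₀ 1 (toL2 F K c₀ (fun b => X (b.translate v)))⟫_ℂ
      = RCLike.re ⟪toL2 F K c₀ X, DeltaEta F n K c₀ 1 (toL2 F K c₀ X)⟫_ℂ := by
  -- both sides through ✓`re_inner_DeltaEta_one` (stated with all letters fixed: no instance-path search in the rewrite)
  have h1 : RCLike.re ⟪toL2 F K c₀ (fun b => X (b.translate v)), DeltaEta F n K c₀ 1 (toL2 F K c₀ (fun b => X (b.translate v)))⟫_ℂ
      = c₀ * (eta F n K)⁻¹ ^ 2 * ∑ p : Plaq (F.P K) 0, ∑ i, ∑ i', ‖curl 1 (fun b => X (b.translate v)) p i i'‖ ^ 2 :=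
    re_inner_DeltaEta_one _
  have h2 : RCLike.re ⟪toL2 F K c₀ X, DeltaEta F n K c₀ 1 (toL2 F K c₀ X)⟫_ℂ
      = c₀ * (eta F n K)⁻¹ ^ 2 * ∑ p : Plaq (F.P K) 0, ∑ i, ∑ i', ‖curl 1 X p i i'‖ ^ 2 :=
    re_inner_DeltaEta_one _
  rw [h1, h2]
  refine congrArg (fun t : ℝ => c₀ * (eta F n K)⁻¹ ^ 2 * t) ?_
  simp only [curl_translate]
  exact sum_plaq_translate v (fun p => ∑ i, ∑ i', ‖curl 1 X p i i'‖ ^ 2)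

/-- ★★ Row (hτΔ) of ✓`coercive_laplaceAc_one_of_sliceBound_conj` DISCHARGED for `τ := τB v` at any slot with `Δx 1 = Δ^η(1)`: `re⟨τB v y, Δx 1 (τB v y)⟩ = re⟨y, Δx 1 y⟩`.
[cite: Balaban1985BackgroundPropagators, (3.10) p.392] -/
theorem re_inner_slot_one_tauB
    (Δx : GaugeField (F.P K) 0 (Matrix.specialUnitaryGroup (Fin 2) ℂ) → (BondL2K ℂ 3 (periodsT3 F K) c₀ W₂ →ₗ[ℂ] BondL2K ℂ 3 (periodsT3 F K) c₀ W₂))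
    (hΔ : Δx 1 = (DeltaEta F n K c₀ 1 : BondL2K ℂ 3 (periodsT3 F K) c₀ W₂ →ₗ[ℂ] BondL2K ℂ 3 (periodsT3 F K) c₀ W₂))
    (v : Site (F.P K) 0) (y : BondL2K ℂ 3 (periodsT3 F K) c₀ W₂) :
    RCLike.re ⟪((toL2 F K c₀).symm.trans ((LinearEquiv.funCongrLeft ℂ (Matrix (Fin 2) (Fin 2) ℂ) (PBond.translateEquiv v)).trans (toL2 F K c₀))) y,
        Δx 1 (((toL2 F K c₀).symm.trans ((LinearEquiv.funCongrLeft ℂ (Matrix (Fin 2) (Fin 2) ℂ) (PBond.translateEquiv v)).trans (toL2 F K c₀))) y)⟫_ℂ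
      = RCLike.re ⟪y, Δx 1 y⟫_ℂ := by
  obtain ⟨X, rfl⟩ := (toL2 F K c₀).surjective y
  rw [tauB_toL2, LinearMap.congr_fun hΔ, LinearMap.congr_fun hΔ, ContinuousLinearMap.coe_coe]
  exact re_inner_DeltaEta_one_translate v X

/-- ★★ **THE TRANSLATIONS AS LINEAR ISOMETRIC EQUIVALENCES, PACKAGED FOR THE PROJECTOR TRANSPORT** ((b2)'s `Rc 1 = τ RS 1 τ⁻¹`): there are linear isometric equivalences `eS` of the gauge
parameters and `eB` of the vector fields acting as the translation by `v` on `toL2S λ`, `toL2 X`, with inverses the translation by `−v`, intertwining the flat letters: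
`D_1 ∘ eS = eB ∘ D_1`, `D*_1 ∘ eB = eS ∘ D*_1`, `Δ^η_1 ∘ eS = eS ∘ Δ^η_1` — so that Mathlib's conjugation of `Submodule.starProjection` under `≃ₗᵢ` applies to `R_S(1) = projR (Δ^η_1) (Q_1D_1)`.
[cite: Balaban1985BackgroundPropagators, (3.21)–(3.23) p.394; Balaban1984PropagatorsII, (2.10)–(2.12) pp.224–225] -/
theorem exists_linearIsometryEquiv_translate (v : Site (F.P K) 0) :
    ∃ (eS : SiteL2K ℂ 3 (periodsT3 F K) c₀ W₂ ≃ₗᵢ[ℂ] SiteL2K ℂ 3 (periodsT3 F K) c₀ W₂)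
      (eB : BondL2K ℂ 3 (periodsT3 F K) c₀ W₂ ≃ₗᵢ[ℂ] BondL2K ℂ 3 (periodsT3 F K) c₀ W₂),
      (∀ lam : Site (F.P K) 0 → Matrix (Fin 2) (Fin 2) ℂ, eS (toL2S F K c₀ lam) = toL2S F K c₀ (fun x => lam (x + v)))
      ∧ (∀ lam : Site (F.P K) 0 → Matrix (Fin 2) (Fin 2) ℂ, eS.symm (toL2S F K c₀ lam) = toL2S F K c₀ (fun x => lam (x + -v)))
      ∧ (∀ X : PBond (F.P K) 0 → Matrix (Fin 2) (Fin 2) ℂ, eB (toL2 F K c₀ X) = toL2 F K c₀ (fun b => X (b.translate v)))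
      ∧ (∀ X : PBond (F.P K) 0 → Matrix (Fin 2) (Fin 2) ℂ, eB.symm (toL2 F K c₀ X) = toL2 F K c₀ (fun b => X (b.translate (-v))))
      ∧ (∀ u, DL2 F n K c₀ 1 (eS u) = eB (DL2 F n K c₀ 1 u))
      ∧ (∀ y, DstarL2 F n K c₀ 1 (eB y) = eS (DstarL2 F n K c₀ 1 y))
      ∧ (∀ u, covLapSite F n K c₀ 1 (eS u) = eS (covLapSite F n K c₀ 1 u)) := by
  set tS := (toL2S F K c₀).symm.trans ((LinearEquiv.funCongrLeft ℂ (Matrix (Fin 2) (Fin 2) ℂ) (Equiv.addRight v)).trans (toL2S F K c₀)) with htS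
  set tB := (toL2 F K c₀).symm.trans ((LinearEquiv.funCongrLeft ℂ (Matrix (Fin 2) (Fin 2) ℂ) (PBond.translateEquiv v)).trans (toL2 F K c₀)) with htB
  refine ⟨⟨tS, fun u => norm_tauS v u⟩, ⟨tB, fun y => norm_tauB v y⟩, fun lam => tauS_toL2S v lam, fun lam => ?_, fun X => tauB_toL2 v X, fun X => ?_,
    fun u => DL2_one_tauS v u, fun y => DstarL2_one_tauB v y, fun u => covLapSite_one_tauS v u⟩
  · -- the inverse of the site translation is the translation by `−v`
    show tS.symm (toL2S F K c₀ lam) = toL2S F K c₀ (fun x => lam (x + -v))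
    rw [LinearEquiv.symm_apply_eq, tauS_toL2S]
    congr 1
    funext x
    rw [add_neg_cancel_right]
  · -- the inverse of the bond translation is the translation by `−v`
    show tB.symm (toL2 F K c₀ X) = toL2 F K c₀ (fun b => X (b.translate (-v)))
    rw [LinearEquiv.symm_apply_eq, tauB_toL2]
    congr 1
    funext b
    rw [translate_translate_neg]

end Flat

/-! ## §4 ★★★ COMB-FLAT COERCIVITY ⟸ (hR) the comb projector is the translate of the S projector + (hv) the slice bound -/

section Knit

variable {F : T3Family} {n K : ℕ} {c₀ : ℝ} [Fact (0 < c₀)]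

/-- ★★★ **COMB-FLAT COERCIVITY FROM THE TUBE∕S CERTIFICATE AND TWO DISPLAYED FLAT ROWS, AT THE ROUTE'S BASE POINT.**  At the flat member, for every `a₀ > 0`, every Hessian slot with
`Δx 1 = Δ^η(1)`, and every lattice vector `v` of the fine torus (RULING №18: `v :=` the half-block diagonal `((L^{K−n}−1)∕2)·(1,1,1)`), if
(hR) `‖R_c(1)(toL2S (λ(· + v)))‖ = ‖R_S(1)(toL2S λ)‖` for every gauge parameter `λ` (the comb gauge projector is the translate of the S one: `N_c(1) = τ·N_S(1)`, `R_c(1) = τ R_S(1) τ⁻¹`, item (b2)) and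
(hv) `a‖Q_kᶜ(1)(toL2 (X(· + v))) − Q_k(1)(toL2 X)‖² ≤ ρ·(re⟨toL2 X, Δ^η(1) toL2 X⟩ + ‖R_S(1)D*_1(toL2 X)‖²)` for every vector field `X` (the slice bound for the gradient-blind `δQ`, item (I3′); `ρ` is where the
K-uniformity lives), then `(1∕(4·Cst 3 a₀·(2+2ρ)))·‖y‖² ≤ re⟨y, Δ_aᶜ(1) y⟩` for ALL `y`, `a = a₀·(c₀∕cB)·(L^{K−n})³`.  Proof: ✓`coercive_laplaceAc_one_of_sliceBound_conj` at `τ := τB v` with (hτn) = `norm_tauB`,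
(hτs) = `tauB_surjective`, (hτΔ) = `re_inner_slot_one_tauB`, and its bond-form (hR) read through `D*_1 ∘ τB v = τS v ∘ D*_1`.
[cite: Balaban1985BackgroundPropagators, Thm 3.11 p.416, (3.26) p.395, (3.115) p.418; Balaban1984PropagatorsI, Prop. 1.1 (1.90) p.33] -/
theorem coercive_laplaceAc_one_of_sliceBound_translate {h : n ≤ K} {cB : ℝ} [Fact (0 < cB)] {a₀ : ℝ} (ha₀ : 0 < a₀)
    (Δx : GaugeField (F.P K) 0 (Matrix.specialUnitaryGroup (Fin 2) ℂ) → (BondL2K ℂ 3 (periodsT3 F K) c₀ W₂ →ₗ[ℂ] BondL2K ℂ 3 (periodsT3 F K) c₀ W₂))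
    (hΔ : Δx 1 = (DeltaEta F n K c₀ 1 : BondL2K ℂ 3 (periodsT3 F K) c₀ W₂ →ₗ[ℂ] BondL2K ℂ 3 (periodsT3 F K) c₀ W₂))
    (v : Site (F.P K) 0)
    (hR : ∀ lam : Site (F.P K) 0 → Matrix (Fin 2) (Fin 2) ℂ,
      ‖Rc F n K h c₀ cB (1 : GaugeField (F.P K) 0 (Matrix.specialUnitaryGroup (Fin 2) ℂ)) (toL2S F K c₀ (fun x => lam (x + v)))‖
        = ‖RS F n K h c₀ cB (1 : GaugeField (F.P K) 0 (Matrix.specialUnitaryGroup (Fin 2) ℂ)) (toL2S F K c₀ lam)‖)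
    {ρ : ℝ} (hρ : 0 ≤ ρ)
    (hv : ∀ X : PBond (F.P K) 0 → Matrix (Fin 2) (Fin 2) ℂ,
      (a₀ * (c₀ / cB) * ((F.L : ℝ) ^ (K - n)) ^ 3)
          * ‖Qkc F n K h c₀ cB (1 : GaugeField (F.P K) 0 (Matrix.specialUnitaryGroup (Fin 2) ℂ)) (toL2 F K c₀ (fun b => X (b.translate v)))
              - Qk F n K h c₀ cB (1 : GaugeField (F.P K) 0 (Matrix.specialUnitaryGroup (Fin 2) ℂ)) (toL2 F K c₀ X)‖ ^ 2
        ≤ ρ * (RCLike.re ⟪toL2 F K c₀ X, Δx 1 (toL2 F K c₀ X)⟫_ℂ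
              + ‖RS F n K h c₀ cB (1 : GaugeField (F.P K) 0 (Matrix.specialUnitaryGroup (Fin 2) ℂ))
                  (DstarL2 F n K c₀ (1 : GaugeField (F.P K) 0 (Matrix.specialUnitaryGroup (Fin 2) ℂ)) (toL2 F K c₀ X))‖ ^ 2))
    (y : BondL2K ℂ 3 (periodsT3 F K) c₀ W₂) :
    (1 / (4 * B5Prop11Plancherel.Cst 3 a₀ * (2 + 2 * ρ))) * ‖y‖ ^ 2
      ≤ RCLike.re ⟪y, laplaceAc F n K h c₀ cB (a₀ * (c₀ / cB) * ((F.L : ℝ) ^ (K - n)) ^ 3) Δx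
          (1 : GaugeField (F.P K) 0 (Matrix.specialUnitaryGroup (Fin 2) ℂ)) y⟫_ℂ := by
  refine coercive_laplaceAc_one_of_sliceBound_conj (h := h) (cB := cB) ha₀ Δx hΔ
    (((toL2 F K c₀).symm.trans ((LinearEquiv.funCongrLeft ℂ (Matrix (Fin 2) (Fin 2) ℂ) (PBond.translateEquiv v)).trans (toL2 F K c₀))).toLinearMap :
      BondL2K ℂ 3 (periodsT3 F K) c₀ W₂ →ₗ[ℂ] BondL2K ℂ 3 (periodsT3 F K) c₀ W₂)
    (fun y' => norm_tauB v y') (tauB_surjective v) (fun y' => re_inner_slot_one_tauB Δx hΔ v y') (fun y' => ?_) hρ (fun y' => ?_) y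
  · -- (hR) in bond form: `D*_1 (τB y′) = τS (D*_1 y′) = toL2S (λ(· + v))` with `λ := toL2S⁻¹ (D*_1 y′)`
    obtain ⟨X, rfl⟩ := (toL2 F K c₀).surjective y'
    rw [LinearEquiv.coe_toLinearMap, tauB_toL2, DstarL2_one_translate]
    conv_rhs => rw [← (toL2S F K c₀).apply_symm_apply (DstarL2 F n K c₀ 1 (toL2 F K c₀ X))]
    exact hR _
  · -- (hv) in bond form
    obtain ⟨X, rfl⟩ := (toL2 F K c₀).surjective y'
    rw [LinearEquiv.coe_toLinearMap, tauB_toL2]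
    exact hv X

end Knit

end Summit.QuantumFields.YangMills.Theorems.Prop7HilbertTranslation

end
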